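import Summits.BirchSwinnertonDyer.BirchSwinnertonDyer.Theorems.SmallImageMuTransferMuTransferX9LocalTransverse
import Summits.BirchSwinnertonDyer.Rank1Residual.GaloisImage.KolyvaginPrimeLocalFreeness
import HarnessLib

/-!
# K6 crux `MuTransferX9` (stmt-BirchSwinnertonDyer-19276), CORE-PLAN S4.2 (file 4): the VALUE of a
# transverse class at a tame generator — `H¹_tr(F, M) ≅ M^{Γ_F}` "evaluation at `σ̄`"
# (MU-TRANSFER-PROOF §2 Lemma 1 (ii): `H¹_tr = Hom(Γ_q, 𝒯_J^{φ̃=1})`, value at `σ̄`; Rubin PCMI 1.9.5 (1))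

Cell `bsd-smallim`, seat `bsd-smallim-koly` gen 7 (route `SmallImageMuTransfer`, rung K6, leaf
`Rank1Residual.BSDpOnClassX9`). HONEST FRAMING: TOOL theorems of local Galois cohomology; no definition,
no named fact, no `sorry`; nothing is asserted about any curve and nothing is booked; class X9 stays
TYPED at class level. Serves the OPEN registered stub `stub_coreX9` of crux 19276 (skeleton v4
0154dd5daf38efd6), CORE-PLAN S4.2 "values at Fr / σ̄", and credits nothing toward its closure
(`--supports … --as helper`). PARTITION (D-0054): X9 (A4) × p ∈ {5, 7} — helper; closes NONE.

## Content (generic: `F` non-archimedean local, `M` finite discrete with trivial inertia action, killed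
by `ℓ − 1`, `ℓ` = residue characteristic, `χ̄_ℓ` onto `(ℤ/ℓ)ˣ` on the inertia group `I_F`)

* `cocycle_apply_eq_of_mem_absInertia_of_chi_eq` — a cocycle's values on `I_F` depend only on `χ̄_ℓ`
  (x9's Step A, as an equation), and `apply_cocycle_apply_eq_self_of_mem_absInertia` — they are
  `Γ_F`-INVARIANT (`φ(gtg⁻¹) = g·φ(t)` and `χ̄_ℓ(gtg⁻¹) = χ̄_ℓ(t)`).
* `exists_evalInertia` — evaluation at `t ∈ I_F` is well defined on CLASSES: an additive map
  `ev_t : H¹(F, M) → M` with `ev_t[φ] = φ(t)` (coboundaries vanish on `I_F`), killing `H¹_ur`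
  (`evalInertia_eq_zero_of_mem_unramifiedSubgroup`), with values in `M^{Γ_F}`.
* `eq_zero_of_mem_transverseSubgroup_of_apply_eq_zero` — a TRANSVERSE class whose cocycle vanishes at ONE
  inertia element `t₀` with `χ̄_ℓ(t₀)` generating `(ℤ/ℓ)ˣ` is zero (its restriction to `I_F` factors
  through `χ̄_ℓ`, so vanishes; unramified ∩ transverse = 0, file 1).
* `exists_transverseSubgroup_addEquiv_invariants` — **`H¹_tr(F, M) ≃+ M^{Γ_F}`, `[φ] ↦ φ(t₀)`** (injective
  by the previous item, bijective by the count `#H¹_tr = #M^{Γ_F}` of file 1): Rubin's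
  `H¹_t(K, A) ≅ Hom(Gal(L/K), A^{ϕ=1}) ≅ A^{ϕ=1}` (value at the generator `σ̄ ↔ t₀`), the companion of
  x9's `nonempty_unramifiedSubgroup_addEquiv_cokerSubOne` (`H¹_ur ≅ M/(φ−1)M`, value at `Fr`).  At an
  `E`-split prime for `𝒯_J`, `M^{Γ} = 𝒯_J^{φ̃=1} = 𝒯_J[T^{p^m}]` (file 2
  `toLocal_twistModP_apply_eq_self_iff_of_split`): the memo's "`κ_q(σ̄) ∈ T^e𝒯_J`".

References: HOME/koly/MU-TRANSFER-PROOF.md §2 Lemma 1 (ii); K. Rubin, *Euler systems and Kolyvagin systems*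
(PCMI 18, 2011) Prop. 1.9.5 (1) [Rubin2011]; B. Mazur, K. Rubin, Mem. AMS 799 (2004) Lemma 1.2.1
[MazurRubin2004].
-/

set_option linter.dupNamespace false
set_option autoImplicit false

noncomputable section

open scoped Classical

universe u

namespace Summit.BirchSwinnertonDyer.BirchSwinnertonDyer.Rank1Residual.LocalSplitPrime

open CategoryTheory ContinuousCohomology Function Field ValuativeRel NumberField IsDedekindDomain
open Literature.NumberTheory.GaloisRepresentations
open Literature.NumberTheory.GaloisRepresentations.IsNonarchimedeanLocalField
open _root_.TopRep
open Literature.NumberTheory.GaloisCohomology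
open Summit.BirchSwinnertonDyer.Rank1Residual.GaloisImage
open Summit.BirchSwinnertonDyer.Rank1Residual (X11b.LocBridge.mem_unramifiedSubgroup_one_iff_forall_eq_zero)

section TransverseValue

variable {F : Type u} [Field F] [ValuativeRel F] [TopologicalSpace F] [IsNonarchimedeanLocalField F]
  {M : Type u} [AddCommGroup M] [TopologicalSpace M] [DiscreteTopology M] [Finite M]
  (ρF : DiscreteGaloisModule F M) (ℓ : ℕ) [Fact ℓ.Prime] [NeZero (ℓ : F)]

/-- **A cocycle's values on the inertia group depend only on `χ̄_ℓ`** (x9's Step A as an equation: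
`φ` vanishes on `I_F ∩ ker χ̄_ℓ` and is additive on `I_F`). [cite: Rubin2011, Prop. 1.9.5 (3) (p. 16)] -/
theorem cocycle_apply_eq_of_mem_absInertia_of_chi_eq (hchar : ringChar 𝓀[F] = ℓ)
    (hI : ∀ t ∈ absInertia F, ∀ m : M, ρF t m = m) (hM : ∀ m : M, (ℓ - 1) • m = 0)
    (hχI : ∀ u : (ZMod ℓ)ˣ, ∃ t ∈ absInertia F, modPCyclotomicCharacterZMod F ℓ t = u)
    (φ : contOneCocycles ρF.toTopRep) {t t' : absoluteGaloisGroup F} (ht : t ∈ absInertia F)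
    (ht' : t' ∈ absInertia F)
    (htt' : modPCyclotomicCharacterZMod F ℓ t = modPCyclotomicCharacterZMod F ℓ t') :
    φ.1 t = φ.1 t' := by
  have h0 := cocycle_apply_eq_zero_of_mem_absInertia_of_modPCyclotomicCharacterZMod_eq_one ρF ℓ
    hchar hI hM hχI φ ((absInertia F).mul_mem ht ((absInertia F).inv_mem ht'))
    (by rw [map_mul, map_inv, htt', mul_inv_cancel])
  rw [cocycle_apply_mul_of_mem_absInertia ρF hI φ ht, cocycle_apply_inv_of_mem_absInertia ρF hI φ ht',
    ← sub_eq_add_neg, sub_eq_zero] at h0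
  exact h0

/-- **A cocycle's values on the inertia group are `Γ_F`-invariant**: `g·φ(t) = φ(gtg⁻¹) = φ(t)`
(`χ̄_ℓ(gtg⁻¹) = χ̄_ℓ(t)`).  So they lie in `M^{Γ_F} = M^{Fr=1}` — the memo's `𝒯_J^{φ̃=1}`.
[cite: Rubin2011, Prop. 1.9.5 (1) (p. 16)] -/
theorem apply_cocycle_apply_eq_self_of_mem_absInertia (hchar : ringChar 𝓀[F] = ℓ)
    (hI : ∀ t ∈ absInertia F, ∀ m : M, ρF t m = m) (hM : ∀ m : M, (ℓ - 1) • m = 0)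
    (hχI : ∀ u : (ZMod ℓ)ˣ, ∃ t ∈ absInertia F, modPCyclotomicCharacterZMod F ℓ t = u)
    (φ : contOneCocycles ρF.toTopRep) {t : absoluteGaloisGroup F} (ht : t ∈ absInertia F)
    (g : absoluteGaloisGroup F) : ρF g (φ.1 t) = φ.1 t := by
  rw [← cocycle_apply_conj_of_mem_absInertia ρF hI φ g ht]
  refine cocycle_apply_eq_of_mem_absInertia_of_chi_eq ρF ℓ hchar hI hM hχI φ ?_ ht ?_
  · exact (inferInstance : (absInertia F).Normal).conj_mem _ ht g
  · rw [map_mul, map_mul, map_inv, mul_inv_cancel_comm]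

omit [Finite M] [Fact ℓ.Prime] [NeZero (ℓ : F)] in
/-- **Evaluation at an inertia element is well defined on `H¹(F, M)`** for `M` with trivial inertia
action (a coboundary `g ↦ gv − v` vanishes on `I_F`): an additive `ev_t : H¹(F, M) → M` with
`ev_t [φ] = φ(t)`. [cite: MazurRubin2004, Lemma 1.2.1] -/
theorem exists_evalInertia (hI : ∀ t ∈ absInertia F, ∀ m : M, ρF t m = m)
    {t : absoluteGaloisGroup F} (ht : t ∈ absInertia F) :
    ∃ ev : galoisCohomology ρF 1 →+ M,
      ∀ φ : contOneCocycles ρF.toTopRep, ev (oneCocycleClass ρF.toTopRep φ) = φ.1 t := by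
  let f : contOneCocycles ρF.toTopRep →+ M :=
    { toFun := fun z => z.1 t
      map_zero' := rfl
      map_add' := fun _ _ => rfl }
  obtain ⟨ev, hev⟩ := FSComp.exists_lift_of_oneCocycles ρF f (fun z hz => by
    obtain ⟨v, hv⟩ := (oneCocycleClass_eq_zero_iff _ z).mp hz
    change z.1 t = 0
    rw [hv t]
    change ρF t v - v = 0
    rw [hI t ht, sub_self])
  exact ⟨ev, fun φ => hev φ⟩

omit [Finite M] [Fact ℓ.Prime] [NeZero (ℓ : F)] in
/-- `ev_t` kills the unramified classes. [cite: MazurRubin2004, Lemma 1.2.1] -/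
theorem evalInertia_eq_zero_of_mem_unramifiedSubgroup
    (hI : ∀ t ∈ absInertia F, ∀ m : M, ρF t m = m) {t : absoluteGaloisGroup F}
    (ht : t ∈ absInertia F) {ev : galoisCohomology ρF 1 →+ M}
    (hev : ∀ φ : contOneCocycles ρF.toTopRep, ev (oneCocycleClass ρF.toTopRep φ) = φ.1 t)
    {c : galoisCohomology ρF 1} (hc : c ∈ DiscreteGaloisModule.unramifiedSubgroup ρF 1) : ev c = 0 := by
  obtain ⟨φ, rfl⟩ := oneCocycleClass_surjective ρF.toTopRep c
  rw [hev]
  exact (X11b.LocBridge.mem_unramifiedSubgroup_one_iff_forall_eq_zero ρF hI φ).1 hc t ht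

/-- `ev_t` takes values in `M^{Γ_F}`. [cite: Rubin2011, Prop. 1.9.5 (1) (p. 16)] -/
theorem apply_evalInertia_eq_self (hchar : ringChar 𝓀[F] = ℓ)
    (hI : ∀ t ∈ absInertia F, ∀ m : M, ρF t m = m) (hM : ∀ m : M, (ℓ - 1) • m = 0)
    (hχI : ∀ u : (ZMod ℓ)ˣ, ∃ t ∈ absInertia F, modPCyclotomicCharacterZMod F ℓ t = u)
    {t : absoluteGaloisGroup F} (ht : t ∈ absInertia F) {ev : galoisCohomology ρF 1 →+ M}
    (hev : ∀ φ : contOneCocycles ρF.toTopRep, ev (oneCocycleClass ρF.toTopRep φ) = φ.1 t)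
    (c : galoisCohomology ρF 1) (g : absoluteGaloisGroup F) : ρF g (ev c) = ev c := by
  obtain ⟨φ, rfl⟩ := oneCocycleClass_surjective ρF.toTopRep c
  rw [hev]
  exact apply_cocycle_apply_eq_self_of_mem_absInertia ρF ℓ hchar hI hM hχI φ ht g

/-- **A transverse class vanishing at one tame generator is zero.**  If `χ̄_ℓ(t₀)` generates `(ℤ/ℓ)ˣ`
and `[φ]` is `F(μ_ℓ)`-transverse with `φ(t₀) = 0`, then `φ` vanishes on all of `I_F` (its restriction
factors through the cyclic group `χ̄_ℓ(I_F)`), so `[φ]` is unramified AND transverse, hence `0`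
(`unramifiedSubgroup_inf_transverseSubgroup_cyclotomicField_eq_bot`). [cite: Rubin2011, Prop. 1.9.5 (1) (p. 16)] -/
theorem eq_zero_of_mem_transverseSubgroup_of_apply_eq_zero (hchar : ringChar 𝓀[F] = ℓ)
    (hI : ∀ t ∈ absInertia F, ∀ m : M, ρF t m = m) (hM : ∀ m : M, (ℓ - 1) • m = 0)
    (hχI : ∀ u : (ZMod ℓ)ˣ, ∃ t ∈ absInertia F, modPCyclotomicCharacterZMod F ℓ t = u)
    {t₀ : absoluteGaloisGroup F} (ht₀ : t₀ ∈ absInertia F)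
    (hgen : ∀ u : (ZMod ℓ)ˣ, u ∈ Subgroup.zpowers (modPCyclotomicCharacterZMod F ℓ t₀))
    (φ : contOneCocycles ρF.toTopRep)
    (hφ : oneCocycleClass ρF.toTopRep φ ∈ DiscreteGaloisModule.transverseSubgroup ρF (CyclotomicField ℓ F))
    (h0 : φ.1 t₀ = 0) : oneCocycleClass ρF.toTopRep φ = 0 := by
  set χ := modPCyclotomicCharacterZMod F ℓ
  -- `φ` vanishes on every power of `t₀`, hence on `I_F`
  have hpow : ∀ n : ℕ, φ.1 (t₀ ^ n) = 0 := fun n => by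
    induction n with
    | zero => rw [pow_zero]; exact contOneCocycles.apply_one φ
    | succ n ih => rw [pow_succ, cocycle_apply_mul_of_mem_absInertia ρF hI φ ((absInertia F).pow_mem ht₀ n),
        ih, h0, add_zero]
  have hzpow : ∀ n : ℤ, φ.1 (t₀ ^ n) = 0 := fun n => by
    cases n with
    | ofNat n => rw [Int.ofNat_eq_natCast, zpow_natCast]; exact hpow n
    | negSucc n =>
      rw [zpow_negSucc, cocycle_apply_inv_of_mem_absInertia ρF hI φ ((absInertia F).pow_mem ht₀ _),
        hpow, neg_zero]
  have hIvan : ∀ t ∈ absInertia F, φ.1 t = 0 := fun t ht => by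
    obtain ⟨n, hn⟩ := Subgroup.mem_zpowers_iff.1 (hgen (χ t))
    rw [cocycle_apply_eq_of_mem_absInertia_of_chi_eq ρF ℓ hchar hI hM hχI φ ht
      ((absInertia F).zpow_mem ht₀ n) (by rw [map_zpow]; exact hn.symm)]
    exact hzpow n
  have hur : oneCocycleClass ρF.toTopRep φ ∈ DiscreteGaloisModule.unramifiedSubgroup ρF 1 :=
    (X11b.LocBridge.mem_unramifiedSubgroup_one_iff_forall_eq_zero ρF hI φ).2 hIvan
  have hmem : oneCocycleClass ρF.toTopRep φ ∈ DiscreteGaloisModule.unramifiedSubgroup ρF 1 ⊓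
      DiscreteGaloisModule.transverseSubgroup ρF (CyclotomicField ℓ F) := AddSubgroup.mem_inf.2 ⟨hur, hφ⟩
  exact (AddSubgroup.eq_bot_iff_forall _).1
    (unramifiedSubgroup_inf_transverseSubgroup_cyclotomicField_eq_bot ρF ℓ hI hχI) _ hmem

/-- **`H¹_tr(F, M) ≅ M^{Γ_F}` by evaluation at a tame generator** (Rubin PCMI Prop. 1.9.5 (1):
`H¹_t(K, A) ≅ Hom(Gal(L/K), A^{ϕ=1})`, and `Hom(ℤ/(ℓ−1), A^{ϕ=1}) = A^{ϕ=1}` at the generator; MU-TRANSFER-PROOF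
Lemma 1 (ii) "`H¹_tr = Hom(Γ_q, 𝒯_J^{φ̃=1})`, value at `σ̄`"): for `t₀ ∈ I_F` with `χ̄_ℓ(t₀)` generating
`(ℤ/ℓ)ˣ` there is an additive isomorphism `e : H¹_tr ≃+ M^{Γ_F}` with `e[φ] = φ(t₀)` — injective by
`eq_zero_of_mem_transverseSubgroup_of_apply_eq_zero`, bijective by the count
`natCard_transverseSubgroup_cyclotomicField_eq_natCard_invariants` (file 1).  The companion of x9's
`nonempty_unramifiedSubgroup_addEquiv_cokerSubOne` (`H¹_ur ≅ M/(φ−1)M`, value at `Fr`).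
[cite: Rubin2011, Prop. 1.9.5 (1) (p. 16)] [cite: MazurRubin2004, Lemma 1.2.1] -/
theorem exists_transverseSubgroup_addEquiv_invariants (hchar : ringChar 𝓀[F] = ℓ)
    (hI : ∀ t ∈ absInertia F, ∀ m : M, ρF t m = m) (hM : ∀ m : M, (ℓ - 1) • m = 0)
    (hχI : ∀ u : (ZMod ℓ)ˣ, ∃ t ∈ absInertia F, modPCyclotomicCharacterZMod F ℓ t = u)
    {t₀ : absoluteGaloisGroup F} (ht₀ : t₀ ∈ absInertia F)
    (hgen : ∀ u : (ZMod ℓ)ˣ, u ∈ Subgroup.zpowers (modPCyclotomicCharacterZMod F ℓ t₀)) :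
    ∃ e : DiscreteGaloisModule.transverseSubgroup ρF (CyclotomicField ℓ F) ≃+ ρF.toTopRep.ρ.invariants,
      ∀ (φ : contOneCocycles ρF.toTopRep)
        (hφ : oneCocycleClass ρF.toTopRep φ ∈ DiscreteGaloisModule.transverseSubgroup ρF (CyclotomicField ℓ F)),
        (e ⟨oneCocycleClass ρF.toTopRep φ, hφ⟩ : M) = φ.1 t₀ := by
  obtain ⟨ev, hev⟩ := exists_evalInertia ρF hI ht₀
  -- the evaluation map restricted to `H¹_tr`, with values in the invariants
  let f : DiscreteGaloisModule.transverseSubgroup ρF (CyclotomicField ℓ F) →+ ρF.toTopRep.ρ.invariants :=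
    { toFun := fun c => ⟨ev c.1, fun g => apply_evalInertia_eq_self ρF ℓ hchar hI hM hχI ht₀ hev c.1 g⟩
      map_zero' := Subtype.ext (by simp)
      map_add' := fun a b => Subtype.ext (by simp) }
  have hf : ∀ c, (f c : M) = ev c.1 := fun _ => rfl
  have hinj : Function.Injective f := by
    intro a b hab
    have h1 : ev a.1 = ev b.1 := congrArg Subtype.val hab
    have h : ev (a - b).1 = 0 := by rw [AddSubgroup.coe_sub, map_sub, h1, sub_self]
    obtain ⟨φ, hφ⟩ := oneCocycleClass_surjective ρF.toTopRep (a - b).1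
    have hφtr : oneCocycleClass ρF.toTopRep φ ∈
        DiscreteGaloisModule.transverseSubgroup ρF (CyclotomicField ℓ F) := by
      rw [hφ]; exact (a - b).2
    rw [← hφ, hev] at h
    have h0 := eq_zero_of_mem_transverseSubgroup_of_apply_eq_zero ρF ℓ hchar hI hM hχI ht₀ hgen φ hφtr h
    rw [hφ] at h0
    exact sub_eq_zero.mp (Subtype.ext h0)
  have hcard : Nat.card (DiscreteGaloisModule.transverseSubgroup ρF (CyclotomicField ℓ F)) =
      Nat.card ρF.toTopRep.ρ.invariants :=
    natCard_transverseSubgroup_cyclotomicField_eq_natCard_invariants ρF ℓ hI hM hχI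
  haveI : Finite ρF.toTopRep.ρ.invariants := inferInstance
  have hbij : Function.Bijective f := (Nat.bijective_iff_injective_and_card f).mpr ⟨hinj, hcard⟩
  exact ⟨AddEquiv.ofBijective f hbij, fun φ hφ => by
    rw [AddEquiv.ofBijective_apply, hf, hev]⟩

end TransverseValue

end Summit.BirchSwinnertonDyer.BirchSwinnertonDyer.Rank1Residual.LocalSplitPrime

end
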